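import Literature.AlgebraicTopology.SingularHomology.HurewiczEilenberg
import Literature.AlgebraicTopology.SingularHomology.CollapseMap
import Literature.AlgebraicTopology.Homotopy.SimplexBallHomeomorph
import HarnessLib

/-!
# Spherical classes generate `Hₙ` of an `(n-1)`-connected space (Hurewicz map onto)

Topic `Literature/AlgebraicTopology/SingularHomology` (fact seat of
`Literature.Topology.FourManifolds.HomotopySphere.exists_highlyConnected_of_mem_signatureSet`,
brick B9a).  A. Hatcher, *Algebraic Topology* (2002), Thm. 4.32: for an `(n-1)`-connected space,
`n ≥ 2`, the Hurewicz map `πₙ(X) → Hₙ(X)`, `[f] ↦ f_*(ι)`, is an isomorphism; A. Kosinski,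
*Differential Manifolds* (1993), X.2, proof of (2.2), consumes its surjectivity: *every class of
`H_k(W)` of a `(k-1)`-connected `W` is represented by a map of a sphere*, which is then made an
embedded sphere and killed by a surgery.  The tree records the Hurewicz isomorphism abstractly
(`hurewicz_iso_holds`); this file extracts the **spherical representability** from the tree's
proof (Spanier's devices):

* `exists_eilenbergSimplex_eq` — for `X` simply connected with `π_k(X) = 0`, `2 ≤ k < m + 2`, and
  any base point `x₀`, every class of `H_{m+2}(X; ℤ)` (Mathlib's singular homology) is the class
  `[σ - c]` of a single singular simplex `σ : Δᵐ⁺² → X` with `σ(∂Δᵐ⁺²) = x₀`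
  (`HurewiczDevice.Device.exists_addEquiv` for the device `collapseDevice`, the surjectivity
  `cls_surjective` of the device classes, and Step 1 `isIso_homologyMap_eilenbergSub_ι`);
* `exists_sphereMap_map_eq` — such a class is `f_* θ` for a continuous `f : 𝕊ᵐ⁺² → X` and a class
  `θ ∈ H_{m+2}(𝕊ᵐ⁺²; ℤ)`: `σ` factors through the collapse `κ : Δᵐ⁺² → Δᵐ⁺²/∂ = 𝕊ᵐ⁺²`
  (`collapseMap` of `CollapseMap.lean` for the interior of the simplex, a quotient map), and
  `θ = [κ - c]`;
* `exists_sphereMap_of_connected` (**main**) — for `X : Type` simply connected with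
  `π_k(X) = 0` for `2 ≤ k < m + 2`, every `c ∈ H_{m+2}(X; ℤ)` is `f_* θ` for some
  `f : C(𝕊ᵐ⁺², X)`, `θ ∈ H_{m+2}(𝕊ᵐ⁺²; ℤ)`.

Everything is proved; no definitions, no named facts.

## References

* A. Hatcher, *Algebraic Topology* (2002), §4.2, Thm. 4.32 and pp. 366–369. [HatcherAT2002]
* E. H. Spanier, *Algebraic Topology* (1981), Ch. 7 §5, Thm. 7.5.5. [Spanier1981]
* A. Kosinski, *Differential Manifolds* (1993), Ch. X §2, proof of Thm. (2.2). [Kosinski1993]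
-/

noncomputable section

open CategoryTheory Limits Set Function Metric Topology
open scoped Topology

universe u

namespace Literature.AlgebraicTopology.SingularHomology

open SingularSimplex eilenbergSimplices

/-! ### Every class is the class of a single Eilenberg simplex -/

section EilenbergRep

variable {X : Type u} [TopologicalSpace X]

/-- The class `[σ - c]` computed in the full concrete complex. [folklore] -/
theorem eilenbergClass_eq (x₀ : X) (k n : ℕ) (h : n ≤ k + 1) (σ : SingularSimplex X n)
    (hσ : σ ∈ eilenbergSimplices X x₀ k n)
    (hz : (csingularChainComplex ℤ ℤ X).d n ((ComplexShape.down ℕ).next n)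
      (Finsupp.single σ 1 - Finsupp.single (constAt x₀ n) 1) = 0) :
    (csingularHomology.compIso ℤ ℤ X n).hom
      (HomologicalComplex.homologyMap (eilenbergSub ℤ ℤ X x₀ k).ι n
        (homologyCls (eilenbergCycle ℤ ℤ σ hσ 1) (d_eilenbergCycle ℤ ℤ h σ hσ 1 _))) =
    (csingularHomology.compIso ℤ ℤ X n).hom
      (homologyCls (Finsupp.single σ 1 - Finsupp.single (constAt x₀ n) 1 :
        (csingularChainComplex ℤ ℤ X).X n) hz) := by
  rw [homologyMap_homologyCls]
  rfl

/-- **Every class of `H_{m+2}` of an `(m+1)`-connected space is the class `[σ - c]` of a single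
singular simplex `σ : (Δᵐ⁺², ∂Δᵐ⁺²) → (X, x₀)`** (Spanier 1981, proof of Thm. 7.5.5: the Hurewicz
inverse `ψ′` is onto and every element of `π_{m+2}` is the class of a simplex; Hatcher Thm. 4.32).
[cite: HatcherAT2002, Thm. 4.32] -/
theorem exists_eilenbergSimplex_eq [SimplyConnectedSpace X] (m : ℕ)
    (hπ : ∀ k : ℕ, 2 ≤ k → k < m + 2 → ∀ x : X, Subsingleton (π_ k X x)) (x₀ : X)
    (c : singularHomology ℤ ℤ X (m + 2)) :
    ∃ (σ : SingularSimplex X (m + 2)) (hσ : σ ∈ eilenbergSimplices X x₀ (m + 1) (m + 2)),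
      c = (csingularHomology.compIso ℤ ℤ X (m + 2)).hom
      (HomologicalComplex.homologyMap (eilenbergSub ℤ ℤ X x₀ (m + 1)).ι (m + 2)
        (homologyCls (eilenbergCycle ℤ ℤ σ hσ 1) (d_eilenbergCycle ℤ ℤ le_rfl σ hσ 1 _))) := by
  -- Step 1: `H(S) ≅ H(X)`
  have hconn : ∀ q : ℕ, 1 ≤ q → q ≤ m + 1 → ∀ y : X, Subsingleton (π_ q X y) := by
    intro q h1q hq y
    rcases Nat.lt_or_ge q 2 with hq2 | hq2
    · obtain rfl : q = 1 := by omega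
      exact (HomotopyGroup.pi1EquivFundamentalGroup : π_ 1 X y ≃ FundamentalGroup X y).subsingleton
    · exact hπ q hq2 (by omega) y
  haveI := isIso_homologyMap_eilenbergSub_ι x₀ (m + 1) hconn ℤ (m + 2)
  let i : (eilenbergSub ℤ ℤ X x₀ (m + 1)).toComplex.homology (m + 2) ≅
      singularHomology ℤ ℤ X (m + 2) :=
    asIso (HomologicalComplex.homologyMap (eilenbergSub ℤ ℤ X x₀ (m + 1)).ι (m + 2)) ≪≫
      csingularHomology.compIso ℤ ℤ X (m + 2)
  -- the device and its isomorphism `e : H(S) ≃+ π`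
  let D := collapseDevice X x₀ m
  obtain ⟨e, he⟩ := D.exists_addEquiv
  let y := i.inv c
  obtain ⟨g, hg, hcls⟩ := D.cls_surjective (Additive.toMul (e y))
  let σ : SingularSimplex X (m + 2) := ofMap g
  have hσ : σ ∈ eilenbergSimplices X x₀ (m + 1) (m + 2) :=
    ofMap_mem fun t ht ↦ hg t (by rw [stdBoundary_eq_stdSkel]; exact ht)
  refine ⟨σ, hσ, ?_⟩
  -- `e [σ - c] = cls σ = cls g = e y`
  have key : ∀ (g' : C(StdSimplex (m + 2), X)) (h' : ∀ t ∈ stdBoundary (m + 2), g' t = x₀),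
      g' = g → D.cls g' h' = D.cls g hg := by
    rintro g' h' rfl; rfl
  have hcls' : D.cls (toContinuousMap σ) (apply_eq_of_mem_stdBoundary (by omega) hσ) =
      Additive.toMul (e y) := by
    rw [key _ _ (toContinuousMap_ofMap g), hcls]
  have hy : homologyCls (eilenbergCycle ℤ ℤ σ hσ 1)
      (d_eilenbergCycle ℤ ℤ (by omega) σ hσ 1 _) = y := by
    apply e.injective
    rw [he σ hσ, hcls']
    rfl
  show c = i.hom (homologyCls (eilenbergCycle ℤ ℤ σ hσ 1) _)
  rw [hy]
  simp [y]

end EilenbergRep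

/-! ### From an Eilenberg simplex to a map of a sphere -/

section Sphere

variable {X : Type} [TopologicalSpace X]

/-- The north pole of `𝕊ᴺ`. [folklore] -/
theorem northPole_mem (N : ℕ) : EuclideanSpace.single (0 : Fin (N + 1)) (1 : ℝ) ∈ (sphere (0 :
    EuclideanSpace ℝ (Fin (N + 1))) 1) := by
  simp

/-- **The interior of the standard simplex is homeomorphic to a punctured sphere**
`Δᴺ ∖ ∂Δᴺ ≅ Bᴺ ≅ ℝᴺ ≅ 𝕊ᴺ ∖ {p}` (radial homeomorphism `SimplexBall.toBall`, `unitBall`,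
stereographic projection). [folklore] -/
theorem nonempty_homeomorph_interior_simplex (N : ℕ) (p : (sphere (0 : EuclideanSpace ℝ (Fin (N +
    1))) 1)) :
    Nonempty (↥((stdBoundary N)ᶜ) ≃ₜ ↥(({p}ᶜ : Set ((sphere (0 : EuclideanSpace ℝ (Fin (N + 1)))
        1))))) := by
  -- interior of the simplex ≅ open unit ball of `Fin N → ℝ`
  let e₁ : ↥((stdBoundary N)ᶜ) ≃ₜ
      {y : closedBall (0 : Fin N → ℝ) 1 // (y : Fin N → ℝ) ∉ sphere (0 : Fin N → ℝ) 1} :=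
    (Homotopy.SimplexBall.toBall N).subtype fun t ↦ by
      rw [mem_compl_iff, Homotopy.SimplexBall.toBall_mem_sphere_iff]; rfl
  let e₂ : {y : closedBall (0 : Fin N → ℝ) 1 // (y : Fin N → ℝ) ∉ sphere (0 : Fin N → ℝ) 1} ≃ₜ
      ball (0 : Fin N → ℝ) 1 :=
    { toFun := fun y ↦ ⟨y.1.1, by
        have h1 := y.1.2
        have h2 := y.2
        rw [mem_closedBall, dist_zero_right] at h1
        rw [mem_sphere_zero_iff_norm] at h2
        rw [mem_ball, dist_zero_right]
        exact lt_of_le_of_ne h1 h2⟩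
      invFun := fun y ↦ ⟨⟨y.1, ball_subset_closedBall y.2⟩, by
        rw [mem_sphere_zero_iff_norm]
        exact (mem_ball_zero_iff.1 y.2).ne⟩
      left_inv := fun _ ↦ rfl
      right_inv := fun _ ↦ rfl
      continuous_toFun := by
        exact (continuous_subtype_val.comp continuous_subtype_val).subtype_mk _
      continuous_invFun := by
        exact (continuous_subtype_val.subtype_mk _).subtype_mk _ }
  let e₃ : ↥(ball (0 : Fin N → ℝ) 1) ≃ₜ (Fin N → ℝ) := Homeomorph.unitBall.symm
  let e₄ : (Fin N → ℝ) ≃ₜ EuclideanSpace ℝ (Fin N) := (EuclideanSpace.equiv (Fin N)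
      ℝ).symm.toHomeomorph
  let e₅ : (EuclideanSpace ℝ (Fin N)) ≃ₜ ↥(({p}ᶜ : Set ((sphere (0 : EuclideanSpace ℝ (Fin (N +
      1))) 1)))) := (SphereComplement.sphereMinusPointHomeomorph p).symm
  exact ⟨e₁.trans (e₂.trans (e₃.trans (e₄.trans e₅)))⟩

/-- **An Eilenberg simplex is a sphere**: for `σ : (Δᴺ, ∂Δᴺ) → (X, x₀)`, `N = n + 1 ≥ 1`, there
are a continuous `f : 𝕊ᴺ → X` and a class `θ ∈ H_N(𝕊ᴺ; ℤ)` with `f_* θ = [σ - c]`: `σ` factors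
through the collapse `κ : Δᴺ → Δᴺ/∂Δᴺ = 𝕊ᴺ` (a quotient map), itself an Eilenberg simplex of
`(𝕊ᴺ, p)`, and `θ = [κ - c]` (Hatcher 2002, §4.2, p. 366: the Hurewicz map through
`(Dⁿ, ∂Dⁿ) → (Dⁿ/∂Dⁿ, pt) = (Sⁿ, pt)`). [cite: HatcherAT2002, Thm. 4.32] -/
theorem exists_sphereMap_map_eq {x₀ : X} {n : ℕ} (σ : SingularSimplex X (n + 1))
    (hσ : σ ∈ eilenbergSimplices X x₀ n (n + 1)) :
    ∃ (f : C((sphere (0 : EuclideanSpace ℝ (Fin (n + 1 + 1))) 1), X)) (θ : singularHomology ℤ ℤ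
        ((sphere (0 : EuclideanSpace ℝ (Fin (n + 1 + 1))) 1)) (n + 1)),
      singularHomology.map ℤ ℤ f (n + 1) θ = (csingularHomology.compIso ℤ ℤ X (n + 1)).hom
      (HomologicalComplex.homologyMap (eilenbergSub ℤ ℤ X x₀ n).ι (n + 1)
        (homologyCls (eilenbergCycle ℤ ℤ σ hσ 1) (d_eilenbergCycle ℤ ℤ le_rfl σ hσ 1 _))) := by
  let p : (sphere (0 : EuclideanSpace ℝ (Fin (n + 1 + 1))) 1) := ⟨EuclideanSpace.single (0 : Fin (n
      + 1 + 1)) (1 : ℝ), northPole_mem (n + 1)⟩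
  obtain ⟨g⟩ := nonempty_homeomorph_interior_simplex (n + 1) p
  have hU : IsOpen ((stdBoundary (n + 1))ᶜ) := (isClosed_stdBoundary (n + 1)).isOpen_compl
  -- the collapse `κ : Δᴺ → 𝕊ᴺ`
  let κ : C(StdSimplex (n + 1), (sphere (0 : EuclideanSpace ℝ (Fin (n + 1 + 1))) 1)) := collapseMap
      hU p g
  have hκ_of_mem : ∀ {t}, t ∈ stdBoundary (n + 1) → κ t = p := fun {t} ht ↦
    collapseMap_apply_of_not_mem hU p g (fun h ↦ h ht)
  have hκ_iff : ∀ t, κ t = p ↔ t ∈ stdBoundary (n + 1) := by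
    intro t
    refine ⟨fun h ↦ ?_, hκ_of_mem⟩
    by_contra ht
    have h' : κ t = g ⟨t, ht⟩ := collapseMap_apply_of_mem hU p g ht
    exact (g ⟨t, ht⟩).2 (by rw [← h', h]; rfl)
  -- `κ` is a quotient map (a closed continuous surjection)
  have hκsurj : Function.Surjective κ := by
    intro y
    by_cases hy : y = p
    · -- a boundary point: the vertex `e₀` has a vanishing coordinate since `N ≥ 1`
      refine ⟨⟨Pi.single (0 : Fin (n + 1 + 1)) 1,
        ⟨fun i ↦ by by_cases h : i = 0 <;> simp [h], by simp [Finset.sum_pi_single']⟩⟩, ?_⟩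
      rw [hy]
      apply hκ_of_mem
      exact ⟨⟨1, by omega⟩, by simp⟩
    · obtain ⟨t, ht⟩ := g.surjective ⟨y, hy⟩
      refine ⟨t.1, ?_⟩
      rw [show κ t.1 = g ⟨t.1, t.2⟩ from collapseMap_apply_of_mem hU p g t.2]
      exact congrArg Subtype.val ht
  have hκq : IsQuotientMap κ := κ.continuous.isClosedMap.isQuotientMap κ.continuous hκsurj
  -- `σ` factors through `κ`
  have hfac : Function.FactorsThrough (toContinuousMap σ) κ := by
    intro a b hab
    by_cases ha : a ∈ stdBoundary (n + 1)
    · have hb : b ∈ stdBoundary (n + 1) := (hκ_iff b).1 (hab ▸ hκ_of_mem ha)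
      rw [apply_eq_of_mem_stdBoundary le_rfl hσ a ha, apply_eq_of_mem_stdBoundary le_rfl hσ b hb]
    · have hb : b ∉ stdBoundary (n + 1) := fun hb ↦ ha ((hκ_iff a).1 (hab.trans (hκ_of_mem hb)))
      have hgab : g ⟨a, ha⟩ = g ⟨b, hb⟩ := by
        apply Subtype.ext
        have h1 : κ a = g ⟨a, ha⟩ := collapseMap_apply_of_mem hU p g ha
        have h2 : κ b = g ⟨b, hb⟩ := collapseMap_apply_of_mem hU p g hb
        rw [← h1, ← h2, hab]
      have hab' : a = b := congrArg Subtype.val (g.injective hgab)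
      rw [hab']
  let f : C((sphere (0 : EuclideanSpace ℝ (Fin (n + 1 + 1))) 1), X) := hκq.lift (toContinuousMap σ)
      hfac
  have hfκ : f.comp κ = toContinuousMap σ := hκq.lift_comp _ hfac
  -- a boundary point, and `f p = x₀`
  let t₀ : StdSimplex (n + 1) := ⟨Pi.single (0 : Fin (n + 1 + 1)) 1,
    ⟨fun i ↦ by by_cases h : i = 0 <;> simp [h], by simp [Finset.sum_pi_single']⟩⟩
  have ht₀ : t₀ ∈ stdBoundary (n + 1) := ⟨⟨1, by omega⟩, by simp [t₀]⟩
  have hfp : f p = x₀ := by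
    rw [← hκ_of_mem ht₀, show f (κ t₀) = (f.comp κ) t₀ from rfl, hfκ]
    exact apply_eq_of_mem_stdBoundary le_rfl hσ t₀ ht₀
  -- `κ` is an Eilenberg simplex of `(𝕊ᴺ, p)`
  have hκE : ofMap κ ∈ eilenbergSimplices ((sphere (0 : EuclideanSpace ℝ (Fin (n + 1 + 1))) 1)) p n
      (n + 1) :=
    ofMap_mem fun t ht ↦ hκ_of_mem (by rw [stdBoundary_eq_stdSkel]; exact ht)
  refine ⟨f, (csingularHomology.compIso ℤ ℤ ((sphere (0 : EuclideanSpace ℝ (Fin (n + 1 + 1))) 1))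
      (n + 1)).hom
      (HomologicalComplex.homologyMap (eilenbergSub ℤ ℤ ((sphere (0 : EuclideanSpace ℝ (Fin (n + 1
          + 1))) 1)) p n).ι (n + 1)
        (homologyCls (eilenbergCycle ℤ ℤ (ofMap κ) hκE 1) (d_eilenbergCycle ℤ ℤ le_rfl (ofMap κ)
            hκE 1 _))), ?_⟩
  -- both classes in the full concrete complexes
  have hz_of : ∀ {Y : Type} [TopologicalSpace Y] {y₀ : Y} (τ : SingularSimplex Y (n + 1))
      (hτ : τ ∈ eilenbergSimplices Y y₀ n (n + 1)),
      (csingularChainComplex ℤ ℤ Y).d (n + 1) ((ComplexShape.down ℕ).next (n + 1))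
        (Finsupp.single τ 1 - Finsupp.single (constAt y₀ (n + 1)) 1) = 0 := by
    intro Y _ y₀ τ hτ
    have h := congrArg Subtype.val
      (d_eilenbergCycle ℤ ℤ (le_refl (n + 1)) τ hτ 1 ((ComplexShape.down ℕ).next (n + 1)))
    rw [Subcomplex.toComplex_d_apply_val, eilenbergCycle_val] at h
    exact h
  rw [eilenbergClass_eq x₀ n (n + 1) le_rfl σ hσ (hz_of σ hσ),
    eilenbergClass_eq p n (n + 1) le_rfl (ofMap κ) hκE (hz_of _ hκE)]
  -- naturality of the comparison isomorphism and of homology classes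
  have nat := csingularHomology.map_comp_compIso_hom (R := ℤ) (M := ℤ) f (n + 1)
  have step1 : singularHomology.map ℤ ℤ f (n + 1) ((csingularHomology.compIso ℤ ℤ ((sphere (0 :
      EuclideanSpace ℝ (Fin (n + 1 + 1))) 1)) (n + 1)).hom
      (homologyCls (Finsupp.single (ofMap κ) 1 - Finsupp.single (constAt p (n + 1)) 1 :
        (csingularChainComplex ℤ ℤ ((sphere (0 : EuclideanSpace ℝ (Fin (n + 1 + 1))) 1))).X (n +
            1)) (hz_of _ hκE))) =
      (csingularHomology.compIso ℤ ℤ X (n + 1)).hom (csingularHomology.map ℤ ℤ f (n + 1)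
        (homologyCls (Finsupp.single (ofMap κ) 1 - Finsupp.single (constAt p (n + 1)) 1 :
          (csingularChainComplex ℤ ℤ ((sphere (0 : EuclideanSpace ℝ (Fin (n + 1 + 1))) 1))).X (n +
              1)) (hz_of _ hκE))) := by
    rw [← ModuleCat.comp_apply, ← nat, ModuleCat.comp_apply]
  rw [step1, csingularHomology.map, homologyMap_homologyCls]
  congr 1
  apply homologyCls_congr
  rw [csingularChainComplex.map_f_apply]
  change Finsupp.mapDomain (fun τ : SingularSimplex ((sphere (0 : EuclideanSpace ℝ (Fin (n + 1 +
      1))) 1)) (n + 1) ↦ τ.map f)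
      ((Finsupp.single (ofMap κ) (1 : ℤ) - Finsupp.single (constAt p (n + 1)) 1 :
        SingularSimplex ((sphere (0 : EuclideanSpace ℝ (Fin (n + 1 + 1))) 1)) (n + 1) →₀ ℤ)) =
    (Finsupp.single σ (1 : ℤ) - Finsupp.single (constAt x₀ (n + 1)) 1 :
      SingularSimplex X (n + 1) →₀ ℤ)
  rw [Finsupp.mapDomain_sub, Finsupp.mapDomain_single, Finsupp.mapDomain_single, ofMap_map,
    constAt_map, hfκ, ofMap_toContinuousMap, hfp]

/-- **Spherical classes exhaust `H_{m+2}` of an `(m+1)`-connected space** (surjectivity of the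
Hurewicz map, Hatcher 2002, Thm. 4.32; the form consumed by surgery below the middle dimension,
Kosinski 1993, X.2): for `X : Type` simply connected with `π_k(X) = 0` for `2 ≤ k < m + 2`, every
`c ∈ H_{m+2}(X; ℤ)` is `f_* θ` for a continuous `f : 𝕊ᵐ⁺² → X` and some
`θ ∈ H_{m+2}(𝕊ᵐ⁺²; ℤ)`. [cite: HatcherAT2002, Thm. 4.32] -/
theorem exists_sphereMap_of_connected [SimplyConnectedSpace X] (m : ℕ)
    (hπ : ∀ k : ℕ, 2 ≤ k → k < m + 2 → ∀ x : X, Subsingleton (π_ k X x))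
    (c : singularHomology ℤ ℤ X (m + 2)) :
    ∃ (f : C((sphere (0 : EuclideanSpace ℝ (Fin (m + 2 + 1))) 1), X)) (θ : singularHomology ℤ ℤ
        ((sphere (0 : EuclideanSpace ℝ (Fin (m + 2 + 1))) 1)) (m + 2)),
      singularHomology.map ℤ ℤ f (m + 2) θ = c := by
  obtain ⟨x₀⟩ := (inferInstance : Nonempty X)
  obtain ⟨σ, hσ, rfl⟩ := exists_eilenbergSimplex_eq m hπ x₀ c
  exact exists_sphereMap_map_eq σ hσ

end Sphere

end Literature.AlgebraicTopology.SingularHomology
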